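import Summits.CriticalPhenomena.SAWScalingLimit.Theses.SAWRenewalTightness
import Literature.Probability.RandomPlanarGeometry.ShellTraversalNet
import Literature.Probability.RandomPlanarGeometry.SAWRestrictionCovariance
import Literature.Probability.RandomPlanarGeometry.PolylineShellTraversals
import Literature.Probability.RandomPlanarGeometry.CurveTortuosity
import Literature.Probability.LatticeModels.MeshDomainJordan
import Literature.Probability.LatticeModels.LatticeDobrushinDomain
import HarnessLib

/-!
# `EventualTight`, line `Sketch`: ANY one aspect ratio (with any collar) carries the bulk leaf

Crux item `stmt-CriticalPhenomena-1372` (`SAWRenewalTightness.EventualTight`; bulk child `BulkShellTight`,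
stmt-CriticalPhenomena-17588), line `Sketch`, registration v12 (lead c11).  Generalisation of the landed rung A
(`stub_aspectReduction`, `…EventualTightAspectReduction.lean`, aspect `2`, collar `4`) to an ARBITRARY aspect
`A > 1` and an ARBITRARY collar factor `K > 0`:

per-shell tightness of the number of separate traversals (`Curve.HasTraversals j y η (A η)`) of the critical
SAW polyline on the interior shells `D(y; η, A η)` whose collar `B̄(y, K η)` lies in `Ω` (hypothesis) gives it on
every interior shell `D(y; η, R)`, `0 < η < R`, `B̄(y, 2R) ⊆ Ω` — the route decl `BulkShellTight` by name.

Why it is recorded (lead c7 §1(c), lead c11): thin ⇒ fat monotonicity of the traversal event makes the lattice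
atom of the line (`VirginArcTraversalTightBounded`, item stmt-CriticalPhenomena-18042, registered at the single
shape `D(z₀; 2N/5, 3N/5)`) WEAKER the thicker the shell; with this file and `…EventualTightAnyShape.lean` the
atom at ANY fixed shape `D(z₀; pN, qN)`, `0 < p < q < 1`, closes the bulk leaf, so an attack on the atom may
choose its shape freely.

Proof (the net argument of rung A, which never used thinness): middle radius `m := (η + R)/2`, half-width
`R' := (R − η)/2`, a net of `M` points `Nᵢ = y + m e^{i(−π + 2πi/M)}` on the circle `|z − y| = m` of resolution
`ρ := 2πm/M < R'/(A + 1 + K)`.  Collars are interior: `B̄(Nᵢ, Kρ) ⊆ B̄(y, m + R') ⊆ B̄(y, 2R) ⊆ Ω`, so the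
hypothesis at `(Nᵢ, ρ, ε/M)` gives thresholds `jᵢ` and mesh bounds `δᵢ`; the net localization
`Curve.exists_net_hasTraversals_of_hasTraversals` turns `Σ_{i<M} jᵢ` separate traversals of `D(y; η, R)` into
`jᵢ` separate traversals of `D(Nᵢ; ρ, R' − ρ) ⊇ D(Nᵢ; ρ, Aρ)`-traversals for some `i`; union bound.
[cite: AizenmanBurchardDuke1999, §1.b and Lemma 3.1]
-/

noncomputable section

open MeasureTheory Filter Topology Set Metric
open scoped ENNReal NNReal unitInterval Real
open Literature.Probability.RandomPlanarGeometry Literature.Probability.LatticeModels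

namespace Summit.CriticalPhenomena.SAWScalingLimit.Theorems

/-- **Aspect reduction at an arbitrary aspect and collar.**  If, for every Dobrushin domain with an endpoint
approximation, every interior shell `D(y; η, A η)` with `B̄(y, K η) ⊆ Ω` and every `ε > 0`, some threshold `j` and
mesh bound `δ₁ > 0` give `P_δ[j separate traversals of D(y; η, A η)] ≤ ε` for `δ ∈ (0, δ₁]` (`A > 1`, `K > 0`
fixed), then `BulkShellTight` holds: the same on every interior shell `D(y; η, R)`, `0 < η < R`, `B̄(y, 2R) ⊆ Ω`.
A finite net on the middle circle, the net localization `Curve.exists_net_hasTraversals_of_hasTraversals`, the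
monotonicity `Curve.HasTraversals.mono'` and a union bound. [cite: AizenmanBurchardDuke1999, §1.b and Lemma 3.1] -/
theorem bulkShellTight_of_bulkShellTightAtAspect :
    ∀ A K : ℝ, 1 < A → 0 < K →
      (∀ (D : DobrushinDomain) (a b : ℝ → Site 2), SAW.IsEndpointApprox D a b →
        ∀ (y : ℂ) (η : ℝ), 0 < η → Metric.closedBall y (K * η) ⊆ D.carrier →
          ∀ ε : ℝ, 0 < ε → ∃ (j : ℕ) (δ₁ : ℝ), 0 < δ₁ ∧ ∀ δ ∈ Set.Ioc (0 : ℝ) δ₁,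
            SAW.law D.carrier δ (a δ) (b δ)
              {γ | (⟨γ.walk.toCurve (meshPoint δ)⟩ : Curve ℂ).HasTraversals j y η (A * η)} ≤
              ENNReal.ofReal ε) →
      Summit.CriticalPhenomena.SAWScalingLimit.Theses.SAWRenewalTightness.BulkShellTight := by
  intro A K hA hK hAK
  unfold Summit.CriticalPhenomena.SAWScalingLimit.Theses.SAWRenewalTightness.BulkShellTight
  intro D a b hab y η R hη hηR hcol ε hε
  classical
  -- (1) radii
  set m : ℝ := (η + R) / 2 with hm_def
  set R' : ℝ := (R - η) / 2 with hR'_def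
  have hmpos : 0 < m := by rw [hm_def]; linarith
  have hR' : 0 < R' := by rw [hR'_def]; linarith
  have hA0 : 0 < A := by linarith
  -- (2) resolution and size of the net
  set ρ₀ : ℝ := R' / (A + 1 + K) with hρ₀_def
  have hden : 0 < A + 1 + K := by linarith
  have hρ₀ : 0 < ρ₀ := by rw [hρ₀_def]; positivity
  set M : ℕ := ⌈2 * π * m / ρ₀⌉₊ + 1 with hM_def
  have hM1 : 1 ≤ M := by omega
  have hMpos : (0 : ℝ) < M := by exact_mod_cast (show 0 < M by omega)
  have hMgt : 2 * π * m / ρ₀ < M := by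
    have h1 := Nat.le_ceil (2 * π * m / ρ₀)
    have h2 : (M : ℝ) = (⌈2 * π * m / ρ₀⌉₊ : ℝ) + 1 := by rw [hM_def]; push_cast; ring
    rw [h2]
    linarith
  set ρ : ℝ := 2 * π * m / M with hρ_def
  have hρ : 0 < ρ := by rw [hρ_def]; positivity
  have hρρ₀ : ρ < ρ₀ := by
    rw [hρ_def, div_lt_iff₀ hMpos]
    have h1 := (div_lt_iff₀ hρ₀).1 hMgt
    linarith [mul_comm (M : ℝ) ρ₀]
  -- `ρ (A + 1 + K) < R'`
  have hρsum : ρ * (A + 1 + K) < R' := by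
    have := (lt_div_iff₀ hden).1 (hρ₀_def ▸ hρρ₀)
    linarith
  have hAρ : A * ρ ≤ R' - ρ := by nlinarith [hK.le, hρ.le]
  have hKρ : K * ρ ≤ R' := by nlinarith [hA0.le, hρ.le]
  -- (3) the net points and their collars
  let N : ℕ → ℂ := fun i => y + (m : ℂ) * Complex.exp (((-π + 2 * π * i / M : ℝ) : ℂ) * Complex.I)
  have hNdist : ∀ i, dist (N i) y = m := fun i => by
    show dist (y + (m : ℂ) * Complex.exp (((-π + 2 * π * i / M : ℝ) : ℂ) * Complex.I)) y = m
    rw [dist_eq_norm, add_sub_cancel_left, norm_mul, Complex.norm_real, Real.norm_eq_abs,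
      abs_of_nonneg hmpos.le, Complex.norm_exp_ofReal_mul_I, mul_one]
  have hcolN : ∀ i, closedBall (N i) (K * ρ) ⊆ D.carrier := fun i => by
    refine (closedBall_subset_closedBall' ?_).trans hcol
    rw [hNdist i]
    rw [hR'_def] at hKρ
    rw [hm_def]
    linarith
  -- (4) the hypothesis at each net point
  set ε' : ℝ := ε / M with hε'_def
  have hε' : 0 < ε' := div_pos hε hMpos
  have key : ∀ i : ℕ, ∃ (j : ℕ) (δi : ℝ), 0 < δi ∧ ∀ δ ∈ Set.Ioc (0 : ℝ) δi,
      SAW.law D.carrier δ (a δ) (b δ)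
        {γ | (⟨γ.walk.toCurve (meshPoint δ)⟩ : Curve ℂ).HasTraversals j (N i) ρ (A * ρ)} ≤
        ENNReal.ofReal ε' :=
    fun i => hAK D a b hab (N i) ρ hρ (hcolN i) ε' hε'
  choose j δi hδi hbound using key
  -- (5) thresholds, net localization and the union bound
  haveI : NeZero M := ⟨by omega⟩
  set δ₁ : ℝ := Finset.univ.inf' Finset.univ_nonempty (fun i : Fin M => δi i) with hδ₁_def
  have hδ₁ : 0 < δ₁ := (Finset.lt_inf'_iff _).2 fun i _ => hδi i
  have hδ₁le : ∀ i : Fin M, δ₁ ≤ δi i := fun i =>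
    Finset.inf'_le (fun i : Fin M => δi i) (Finset.mem_univ i)
  refine ⟨∑ i ∈ Finset.range M, j i, δ₁, hδ₁, fun δ hδ => ?_⟩
  -- the event inclusion
  have hsubev : {γ : SAW.DomainSAW D.carrier δ (a δ) (b δ) |
        (⟨γ.walk.toCurve (meshPoint δ)⟩ : Curve ℂ).HasTraversals
          (∑ i ∈ Finset.range M, j i) y η R} ⊆
      ⋃ i : Fin M,
        {γ | (⟨γ.walk.toCurve (meshPoint δ)⟩ : Curve ℂ).HasTraversals (j i) (N i) ρ (A * ρ)} := by
    intro γ hγ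
    obtain ⟨i, hiM, htrav⟩ :=
      Curve.exists_net_hasTraversals_of_hasTraversals hη.le hηR hM1 j hγ
    refine Set.mem_iUnion.2 ⟨⟨i, hiM⟩, ?_⟩
    exact htrav.mono' le_rfl hAρ
  calc SAW.law D.carrier δ (a δ) (b δ) {γ : SAW.DomainSAW D.carrier δ (a δ) (b δ) |
          (⟨γ.walk.toCurve (meshPoint δ)⟩ : Curve ℂ).HasTraversals
            (∑ i ∈ Finset.range M, j i) y η R}
      ≤ SAW.law D.carrier δ (a δ) (b δ) (⋃ i : Fin M,
          {γ | (⟨γ.walk.toCurve (meshPoint δ)⟩ : Curve ℂ).HasTraversals (j i) (N i) ρ (A * ρ)}) :=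
        measure_mono hsubev
    _ ≤ ∑ i : Fin M, SAW.law D.carrier δ (a δ) (b δ)
          {γ | (⟨γ.walk.toCurve (meshPoint δ)⟩ : Curve ℂ).HasTraversals (j i) (N i) ρ (A * ρ)} :=
        measure_iUnion_fintype_le _ _
    _ ≤ ∑ _i : Fin M, ENNReal.ofReal ε' :=
        Finset.sum_le_sum fun i _ => hbound i δ ⟨hδ.1, hδ.2.trans (hδ₁le i)⟩
    _ = ENNReal.ofReal (M * ε') := by
        rw [Finset.sum_const, Finset.card_univ, Fintype.card_fin, nsmul_eq_mul,
          ENNReal.ofReal_mul (Nat.cast_nonneg M), ENNReal.ofReal_natCast]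
    _ = ENNReal.ofReal ε := by
        congr 1
        rw [hε'_def]
        field_simp

/-- The landed aspect-two rung A is the instance `A = 2`, `K = 4` (sanity check of the generalisation; one line).
[cite: AizenmanBurchardDuke1999, §1.b and Lemma 3.1] -/
theorem bulkShellTight_of_bulkShellTightAtAspectTwo'
    (h2 : ∀ (D : DobrushinDomain) (a b : ℝ → Site 2), SAW.IsEndpointApprox D a b →
      ∀ (y : ℂ) (η : ℝ), 0 < η → Metric.closedBall y (4 * η) ⊆ D.carrier →
        ∀ ε : ℝ, 0 < ε → ∃ (j : ℕ) (δ₁ : ℝ), 0 < δ₁ ∧ ∀ δ ∈ Set.Ioc (0 : ℝ) δ₁,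
          SAW.law D.carrier δ (a δ) (b δ)
            {γ | (⟨γ.walk.toCurve (meshPoint δ)⟩ : Curve ℂ).HasTraversals j y η (2 * η)} ≤
            ENNReal.ofReal ε) :
    Summit.CriticalPhenomena.SAWScalingLimit.Theses.SAWRenewalTightness.BulkShellTight :=
  bulkShellTight_of_bulkShellTightAtAspect 2 4 (by norm_num) (by norm_num) h2

end Summit.CriticalPhenomena.SAWScalingLimit.Theorems

end
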